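import Mathlib
import HarnessLib
import HarnessLib.Audit
import Summits.AtomisticToContinuum.Statement
import Literature.MathematicalPhysics.StatisticalMechanics.LennardJonesClusters
import Literature.MathematicalPhysics.StatisticalMechanics.BarlowStacking
import Literature.Geometry.DiscreteGeometry.KissingPatterns
import Summits.AtomisticToContinuum.Crystallization.Theorems.ExcessDecayLiouvilleCrysEnergyLimit
import HarnessLib.Audit.Status.Attr

/-!
Route: PalmUnimodularRigidity

DORMANT since 2026-08-26T06:31:04Z (reconciler: no traction for 8.4 d (last activity item-evidence-added at 2026-08-17T20:21:40Z); parked, not closed — `ledger route dormant route-AtomisticToContinuum-PalmUnimodularRigidity --off` to re) — unstaffed, not closed; items shared with open routes are served there. `ledger route dormant <id> --off` reactivates.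

# Route PalmUnimodularRigidity — Palm-unimodular zero-pressure limit of LJ ground states; classify
the minimising point-stationary hard-core laws (HCP rigidity)

X = PalmRigidity ("it suffices to classify the minimisers"). For every hard core δ > 0 and every
probability law P on
ROOTED δ-separated configurations of ℝ³ (counting measures μ = count|S, 0 ∈ S, encoded as `Measure
(Measure ℝ³)`) which is
POINT-STATIONARY (Mecke / mass-transport identity E_P Σ_(y∈μ) g(μ, y) = E_P Σ_(y∈μ) g(θ_y μ, −y) for
every measurable g ≥ 0,
θ_y μ = μ(· + y)) and MINIMISING (E_P[h] ≤ e* := ⨅ over periodic Q of e(Q), where h(μ) = ½ ∫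
V_LJ(‖y‖) dμ(y) is the energy
of the root), P-almost every μ is a rotated relaxed HCP crystal: μ = count|A(hcpStacking a h) with A
∈ O(3), (a, h) ∈ [1/2, 2]²
and e(hcp a h) = e*. Realises card palm-unimodular-zero-pressure-limit: uniformly rooted LJ ground
states P_N satisfy mass
transport EXACTLY and E(N)/N = E_(P_N)[h] EXACTLY, so every Benjamini–Schramm limit is a minimising
point-stationary law; X then
yields attainment of the periodic minimum by reading one sample (conjunct (i)) and Blanc–Lewin (16)
by transferring the a.s. structure
back to a positive density of good particles (conjunct (ii)). X is decomposed at open as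
MinimiserShells ∧ ShellsToBarlowChart ∧
LayeredLawsSelectHcp → X (glue CruxesToPalmRigidity). Relation to route BenjaminiSchrammGroundStates
(sibling card, opened 11:09Z the
same day, STATIONARY side with NoFoam as a crux): this route is its declared Palm-side pivot target
— NoFoam-free, because e_uni ≥ e*
holds for every point-stationary hard-core law — and files the content cruxes its two-layer plan
only foresees; PalmToHinge derives
ITS finite-N hinge GroundStatesChargePeriodic (shared item 2911) from X (both routes were retired
`not-a-thesis` in the D-0027 §2.1
audit of 13:45Z because their assemblies named `Literature.…Crystallization` instead of the
sub-problem decl; this is the conforming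
re-filing of route-AtomisticToContinuum-PalmUnimodularLimit, same statements, with the deciding
theorem `closes : … → Crystallization`
supplied sorry-free in glue.lean).
Lean: `∀ δ : ℝ, 0 < δ → ∀ P : MeasureTheory.Measure (MeasureTheory.Measure (EuclideanSpace ℝ (Fin
3))), MeasureTheory.IsProbabilityMeasure P → (∀ᵐ μ ∂P, (∃ S : Set (EuclideanSpace ℝ (Fin 3)), (0 :
EuclideanSpace ℝ (Fin 3)) ∈ S ∧ (∀ x ∈ S, ∀ y ∈ S, x ≠ y → δ ≤ dist x y) ∧ μ =
(MeasureTheory.Measure.count : MeasureTheory.Measure (EuclideanSpace ℝ (Fin 3))).restrict S)) → (∀ g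
: MeasureTheory.Measure (EuclideanSpace ℝ (Fin 3)) → EuclideanSpace ℝ (Fin 3) → ENNReal, Measurable
(Function.uncurry g) → ∫⁻ μ, ∫⁻ y, g μ y ∂μ ∂P = ∫⁻ μ, ∫⁻ y, g (MeasureTheory.Measure.map (fun z =>
z - y) μ) (-y) ∂μ ∂P) → (∫ μ, (∫ y, Literature.MathematicalPhysics.StatisticalMechanics.lennardJones
‖y‖ ∂μ) / 2 ∂P) ≤ (⨅ Q : Literature.MathematicalPhysics.StatisticalMechanics.PeriodicConfiguration
3, Q.energyPerParticle Literature.MathematicalPhysics.StatisticalMechanics.lennardJones) → ∀ᵐ μ ∂P,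
(∃ a h : ℝ, ∃ ha : a ≠ 0, ∃ hh : h ≠ 0, 1 / 2 ≤ a ∧ a ≤ 2 ∧ 1 / 2 ≤ h ∧ h ≤ 2 ∧ ∃ A : EuclideanSpace
ℝ (Fin 3) ≃ₗᵢ[ℝ] EuclideanSpace ℝ (Fin 3),
(Literature.MathematicalPhysics.StatisticalMechanics.hcpPeriodicConfiguration ha
hh).energyPerParticle Literature.MathematicalPhysics.StatisticalMechanics.lennardJones = (⨅ Q :
Literature.MathematicalPhysics.StatisticalMechanics.PeriodicConfiguration 3, Q.energyPerParticle
Literature.MathematicalPhysics.StatisticalMechanics.lennardJones) ∧ μ = (MeasureTheory.Measure.count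
: MeasureTheory.Measure (EuclideanSpace ℝ (Fin 3))).restrict (A ''
Literature.MathematicalPhysics.StatisticalMechanics.hcpStacking a h))`

## Assembly
DECIDING THEOREM (D-0027 §2.1): glue.lean `theorem closes (MinimiserShells) (ShellsToBarlowChart)
(LayeredLawsSelectHcp)
(CruxesToPalmRigidity) (BenjaminiSchrammLimit) (PalmToHinge) (ChargedPatternCrystallizes)
(CrysEnergyLimit) (CrysPeriodicBddBelow) :
Crystallization` — the nine load-bearing items, conclusion the sub-problem decl by name, PROVED
sorry-free (axioms propext,
Classical.choice, Quot.sound; 25 lines of logic plus two proved Literature facts). The Assembly item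
below is the same implication as a
Prop and is provable now by the same script. Content of the proof: the three cruxes and
CruxesToPalmRigidity give PalmRigidity; PalmToHinge with BenjaminiSchrammLimit and
CrysEnergyLimit gives the shared hinge GroundStatesChargePeriodic, and ChargedPatternCrystallizes
with LennardJonesMinimalDistance_holds
gives IsCrystallizing (conjunct (ii)); for conjunct (i): LennardJonesGroundStatesExist_holds
supplies a ground-state sequence;
BenjaminiSchrammLimit gives φ, δ, P with E(φ j)/φ j → E_P[h]; CrysEnergyLimit and
tendsto_nhds_unique force E_P[h] = e*, so P is
minimising; PalmRigidity gives P-a.s. HCPCFG and P ≠ 0 yields (a, h) with e(hcp a h) = e* = ⨅, i.e.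
IsLeast by CrysPeriodicBddBelow
(ciInf_le), and E(N)/N → e(hcp a h): HasPeriodicGroundStateEnergy. UnimodularEnergyLowerBound is not
in the chain: it is the e_uni = e*
step every crux prover needs (and the reason NoFoam is not an item); the target PalmRigidity and the
shared hinge 2911 are DERIVED items
(closed by one-line Theorems files once their antecedents close).

Rationale: WHY THIS LINE. Root each finite ground state at a uniformly random particle: the rooted empirical
field P_N is unimodular because mass transport is a
finite double count (AldousSteele2004, AldousLyons2007), and E(N)/N is its exact expected root
energy; hard core δ = 1/3
(LennardJonesMinimalDistance_holds, in tree) makes the rooted configuration space compact, so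
subsequential limits exist, stay
point-stationary (= Palm, HevelingLast2005, LastThorisson2009, LastPenrose2017 ch. 9) and inherit
E_P[h] = lim E(N)/N = e*
(0626, refuter-certified bookkeeping). Both Blanc–Lewin conjuncts (BlancLewin2015 §2.1 (15)–(18))
then become ONE statement about
minimisers of a LINEAR functional on point-stationary hard-core laws — Radin's "crystal problem =
support of minimising invariant
measures" (Radin1987, Radin1991; Lewin2022 Def. 11 for confined Riesz gases) with the Palm side
first, so that there is no boundary,
no pressure, no N^{2/3} bookkeeping, and every strict energy-density inequality is a density-zero /
almost-sure statement.
Imported areas: Palm theory and unimodular random networks (probability), ergodic decomposition,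
discrete geometry of 12-neighbour
packings (Hales2012, HalesDSP2012 §1.3 — the exact layer theorem is proved in tree), 1-D long-range
lattice gases (Hägg selection, 0737).
What prior routes do not do: CrystalKissingRigidity / CrystalLocalRigidity fight the surface at
finite N (o(N) defect counts,
E(N) ≥ Ne* − CN^{2/3}, ≤ K fault planes); here finite N enters only through the exact identity
E(N)/N = E_(P_N)[h] and a transfer lemma,
NoFoam is a corollary (minimisers are HCP, hence not sheets) rather than an input, and e_uni ≥ e*
holds for ALL point-stationary
hard-core laws by a random-grid mass transport (support UnimodularEnergyLowerBound), so
zero-intensity limits need no special case.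

RANKED CRUXES. #0 PalmRigidity (target) — X as in § Thesis: every minimising point-stationary
hard-core probability law on rooted configurations of ℝ³ is almost surely a rotated relaxed HCP
crystal count|A(hcpStacking a h), (a,h) ∈ [1/2,2]², with e(hcp a h) = e* (card items U1+U2 at the
measure level). (why it might fail: False if some minimising point-stationary law is not HCP:
fcc/polytype degeneracy decided at the 1e-4 level by the uncertified tail couplings (0670), or a
genuinely non-close-packed LJ ground state; either would also sink the sphere-packing-heritage
routes.) [Radin1991, Radin1987, AldousLyons2007, arXiv:2202.09240, LastThorisson2009,
HevelingLast2005, BlancLewin2015, Stillinger2001]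
#2 MinimiserShells (crux) — MEASURE-LEVEL LOCAL STRUCTURE (card U1): for every δ > 0 and every
point-stationary hard-core probability law P with E_P[h] ≤ e*, P-a.s. the root has a close-packed
first shell: there is a scale a ∈ [9/10, 1] such that the configuration points y ≠ 0 with ‖y‖ ≤ 5a/4
are exactly twelve and, after a rotation, (a/100)-matched to the a-scaled FCC (cuboctahedron) or HCP
(anticuboctahedron) kissing pattern (`ShellCloseTo`). By unimodularity the same then holds at every
point. The frustration crux: at the measure level it is an expectation inequality E_P[h] ≥ e* +
c·P(bad root shell) over point-stationary laws, where mass-transport / Mecke identities of the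
typical Delaunay star are available as exact linear constraints. [difficulty: open-problem] (why it
might fail: A point-stationary hard-core law with E_P[h] ≤ e* but icosahedral/polytetrahedral or
amorphous root shells (LJ13 is icosahedral; one 12-shell is flexible) refutes it, i.e. a
non-close-packed LJ ground state; no measure-level local energy inequality is known in d = 3.)
[BlancLewin2015, Hales2012, Literature.Barriers.AtomisticToContinuum.IcosahedralClusters,
Literature.Barriers.AtomisticToContinuum.FlexibleKissingArrangements,
Literature.Barriers.AtomisticToContinuum.TetrahedralFrustration, Stillinger2001, Radin1991]
#3 LayeredLawsSelectHcp (crux) — SELECTION AND RIGIDITY IN DENSITY FORM (card U2 + elastic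
rigidity): a minimising point-stationary hard-core law that is a.s. carried by configurations S all
of whose points have (1/100)-close-packed shells AND which are globally bond-isomorphic to an ideal
Barlow stacking (a bijection Φ from barlowStacking 1 √(2/3) s, s a Hägg sequence, onto S with ideal
contacts ↔ pairs at distance in (0, 28/25]) is a.s. an exact rotated relaxed HCP crystal with
optimal parameters: μ = count|A(hcpStacking a h), e(hcp a h) = e*. Mechanism: linearity of E_P[h] +
Hägg domination (0737 with the couplings of 0670) give fault density 0, hence no faults a.s. for
ergodic components; harmonic + anharmonic stability of relaxed hcp in the 1 % tube kills the
displacement field; e(hcp a h) ≥ e* ≥ E_P[h] pins (a,h). [deps: ShellsToBarlowChart] [difficulty: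
XL] (why it might fail: Needs e(hcp) < e(fcc) and Hägg domination for the FULL r^-6 tail (J2 ≈
-7.3e-5, margin ≈ 287, uncertified: item 0670) robust to layer-dependent relaxation, plus
phonon/elastic rigidity of relaxed hcp inside the 1 % tube; fcc optimal, a competitive polytype or a
soft mode falsifies the HCP clause.) [Stillinger2001, LoachAckland2017, PartayOrtnerCsanyi2017,
arXiv:2107.14020, stmt-AtomisticToContinuum-0737, stmt-AtomisticToContinuum-3063,
stmt-AtomisticToContinuum-0670,
Literature.Barriers.AtomisticToContinuum.ShortRangeStackingBlindness,
Literature.Barriers.AtomisticToContinuum.Hubbard1978_mostHomogeneous]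
#4 ShellsToBarlowChart (crux) — ROBUST LAYER THEOREM (pure geometry, no potential, no measure): a
non-empty set S ⊂ ℝ³ in which EVERY point x has a (1/100)-close-packed first shell at its own scale
a_x ∈ [9/10, 1] (twelve points within 5a_x/4, matched after rotation to the a_x-scaled FCC or HCP
pattern, nothing else that close) is globally bond-isomorphic to an ideal Barlow stacking: there are
a Hägg sequence s and a bijection Φ : barlowStacking 1 √(2/3) s → S with dist p q = 1 ↔ 0 < dist (Φ
p) (Φ q) ≤ 28/25. The exact case (slack 0, conclusion a congruence) is Hales, Dense Sphere Packings
§1.3, proved in tree as HalesDSP_layerPackings_holds; metric closeness is NOT claimed globally (slow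
elastic drift is allowed), only the combinatorics. [difficulty: L] (why it might fail: At 1 % slack
an every-point-FCC/HCP-shelled Delone set with exotic global topology — e.g. hcp-type layers on
non-parallel close-packed planes of an fcc matrix meeting without any badly coordinated junction
atom — would break the single global Hägg sequence (the exact case forbids it).) [HalesDSP2012,
Hales2012, arXiv:1611.10297, stmt-AtomisticToContinuum-0758,
Literature.Barriers.AtomisticToContinuum.KissingTwelveDegeneracy,
Literature.Barriers.AtomisticToContinuum.FlexibleKissingArrangements]
#9 CrysEnergyLimit (support) — shared bookkeeping item 0626 (E(N)/N → ⨅ periodic e(Q);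
refuter-certified SOFT: periodisation 0715 + trial states 0629 + Fekete + LJ stability, all inputs
proved or folklore) — identifies E_P[h] of the Benjamini–Schramm limit with e*. [difficulty: M]
[BlancLewin2015, stmt-AtomisticToContinuum-0626]
#9 CrysPeriodicBddBelow (support) — shared bookkeeping item 0714 (periodic LJ energies per particle
are bounded below; LJ stability lennardJones_stable_holds + finite blocks) — makes ⨅ a genuine
infimum (ciInf_le) in the assembly. [difficulty: provable-now] [BlancLewin2015,
stmt-AtomisticToContinuum-0714]
#9 GroundStatesChargePeriodic (support) — SHARED item stmt-AtomisticToContinuum-2911 (crux rank 3 of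
route BenjaminiSchrammGroundStates; support here, derived from the target by PalmToHinge): for every
sequence of LJ ground states there is ONE periodic Q such that for all R, ε > 0 some ρ > 0 bounds
from below, for infinitely many N, the fraction of particles whose R-neighbourhood is ε-matched both
ways with x_i + A(Q.points − q), A a linear isometry, q ∈ Q.points. [difficulty: XL]
[BlancLewin2015, stmt-AtomisticToContinuum-2911, AldousSteele2004]
#9 ChargedPatternCrystallizes (support) — SHARED soft item stmt-AtomisticToContinuum-2916 of route
BenjaminiSchrammGroundStates: GroundStatesChargePeriodic → LennardJonesMinimalDistance →
IsCrystallizing lennardJones 3 (diagonal extraction, compactness of O(3),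
PeriodicConfiguration.tendsto_sum_of_eventually_near′ in tree; the minimal-distance fact is
LennardJonesMinimalDistance_holds). [difficulty: M] [BlancLewin2015, stmt-AtomisticToContinuum-2916]
#9 CruxesToPalmRigidity (support) — glue of the foreseen decomposition of the target:
MinimiserShells → ShellsToBarlowChart → LayeredLawsSelectHcp → PalmRigidity. Content: the unimodular
"root a.s. ⇒ every point a.s." lemma (mass transport with g(μ,y) = 1[shell at y bad]) and the
identification of the points of count|S shifted by −x with S − x; measurability of the shell event
is the Lean cost. [difficulty: M] [AldousLyons2007, LastThorisson2009]
#9 UnimodularEnergyLowerBound (support) — e_uni ≥ e* (card A2, NO intensity / NoFoam hypothesis):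
every point-stationary hard-core probability law has E_P[h] ≥ e* = ⨅ periodic e(Q). Proof sketch:
adjoin an independent uniform phase U of the grid Lℤ³ (the marked law stays unimodular); transport
(h_y − e*)/n_cell from each point y to the points of its grid cell; mass received at the root =
(Σ_cell h_y − n e*)/n ≥ −C·n_∂/n − ε(R₀) by E(n) ≥ n e* (periodisation, 0715) and the r^-6 tail; and
E[n_∂/n] = P(root within R₀ of its cell boundary) = O(R₀/L) by a second mass transport. Hence
minimising laws have E_P[h] = e* exactly. [difficulty: L] [LastThorisson2009,
stmt-AtomisticToContinuum-0715, doi:10.1007/s00454-002-2791-7, Radin1991]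
#9 BenjaminiSchrammLimit (support) — CONSTRUCTION (card U3; existence kept separate from the
interface): for every sequence of LJ ground states x^N there are a subsequence φ, a hard core δ > 0
and a probability law P on rooted δ-separated configurations which is point-stationary, has E_P[h] =
lim_j E(φ j)/φ j (stated as Tendsto), and is a LOCAL LIMIT in the density-transfer (portmanteau)
form the assembly uses: for every set T of configurations, every R, ε > 0 and every ρ < P(T), for
all large j at least ρ·φ(j) particles i of x^(φ j) have their recentred configuration (R, ε)-matched
(both ways, inside the ball of radius R) to some ν ∈ T. Proof: P_N := (1/N) Σ_i δ_(count|(x^N −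
x_i)); mass transport is an exact finite identity; E_(P_N)[h] = E(N)/N; compactness of rooted
(1/3)-separated configurations in the local topology (LennardJonesMinimalDistance_holds); h is a
uniform limit of bounded local continuous functionals (tail ≤ C R^-3); unimodularity passes to the
limit; transfer by Skorokhod / portmanteau with open fattenings. [difficulty: XL] [AldousLyons2007,
AldousSteele2004, LastPenrose2017, BlancLewin2015, HevelingLast2005]
#9 PalmToHinge (support) — glue from the target to the SHARED finite-N hinge of route
BenjaminiSchrammGroundStates: PalmRigidity → BenjaminiSchrammLimit → CrysEnergyLimit →
GroundStatesChargePeriodic (item 2911: ONE periodic Q charged with positive density at every scale,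
frequently in N). Proof: the Benjamini–Schramm limit P of the given sequence is minimising
(CrysEnergyLimit), hence a.s. rotated relaxed HCP (PalmRigidity); pick (a, h) in the topological
support of the (a, h)-marginal (compact box), Q := hcpPeriodicConfiguration a h, q := 0;
configurations hcp(a′, h′) with |a′ − a|, |h′ − h| ≤ ε/(C R) are (R, ε/2)-close to hcp(a, h) index
by index, so T := such configurations has P(T) > 0 and the density transfer gives ≥ ρ N matched
particles with ρ = P(T)/2. No NoFoam, no Palm inversion. [difficulty: M] [AldousLyons2007,
stmt-AtomisticToContinuum-2911]

TWO-LAYER PLAN. Foreseen glued splits (k ≤ 3, depth 1), filed only when a crux moves: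
MinimiserShells ⇐ PalmTwelveCoordination (a.s. exactly 12
neighbours within (1+η)a and an empty annulus up to 5a/4 for minimising laws; the LJ-specific
expectation inequality, possibly an LP
certificate over Palm shell statistics with MTP/Euler identities as constraints) →
RobustLocalFejesToth (12-coordinated with gap on B_3
⇒ shell ε-close to FCC/HCP; compactness + Hales's LOCAL proof of Thm 1, taking flyspeck_L12 and
Hales2012_contactGraphTame as hypotheses)
→ MinimiserShells. LayeredLawsSelectHcp ⇐ HaggDominationDensity (0737 + the typed certified
couplings LjRegistryDomination 3063 / 0670, in density form: fault density 0) →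
HcpElasticRigidity (harmonic + cubic remainder positivity of relaxed hcp in the 1 % tube, certified)
→ LayeredLawsSelectHcp.
ShellsToBarlowChart ⇐ PerturbedStarCombinatorics (1 %-shells have the exact adjacency combinatorics
of the ideal patterns) →
LayerPropagationWithSlack (LayerPropagation.lean with tolerances) → ShellsToBarlowChart.

KILL CRITERIA. MinimiserShells refuted (a point-stationary hard-core law with E_P[h] ≤ e* and
non-close-packed shells = a non-crystalline LJ ground
state in the limit) closes this route AND every sphere-packing-heritage route; record the witness
law as negative knowledge. PalmRigidity or
LayeredLawsSelectHcp refuted because fcc or another PERIODIC stacking wins for the full tail: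
restate HCPCFG with the winning
barlowPeriodicConfiguration (route edit --restate; the framework survives), but if the optimal
stacking is aperiodic with unattained
infimum (route RefuteCrystalPeriodicMin succeeds, 0627 refuted) the conjunct itself dies.
ShellsToBarlowChart refuted by an exotic
every-point-good Delone set: pivot to local charts plus an energetic exclusion inside
LayeredLawsSelectHcp (resplit), not a close.
BenjaminiSchrammLimit is soft; if its Lean cost proves prohibitive the route parks, it is not
refuted. If route BenjaminiSchrammGroundStates closes its hinge 2911 first (via NoFoam), this
route's assembly still needs only PalmRigidity for conjunct (i); if the two routes converge, the
later one is closed `superseded --by`. Crystallization proved elsewhere moots it.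

NOT DECOMPOSED YET. The 12-coordination sub-step and the robust local Fejes Tóth lemma (children of
MinimiserShells; the latter needs the computer-assisted
named facts flyspeck_L12 / Hales2012_contactGraphTame as hypotheses and is deliberately kept out of
the cone at open); certified J_k,
phonon positivity and the uniqueness of the optimal (a, h) (children of LayeredLawsSelectHcp; (a, h)
sits inside the a.s. so uniqueness is
not load-bearing); ergodic decomposition and the "root a.s. ⇒ everywhere a.s." lemma (inside the
glue); the local (vague) topology,
Prokhorov/Riesz–Markov and Skorokhod steps (inside BenjaminiSchrammLimit); Literature definitions
IsPointStationaryLaw / rootEnergy that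
would shorten every signature (requested after open); the measure-level attainment lemma
ChargedHcpAttains (a minimising point-stationary
law charging rotated relaxed HCP ⇒ 0627, by conditioning on the re-rooting-invariant event — no
surgery; typed and checked in the
planner's Sketch of the retired predecessor, item 4083) is left for provers to attach with
--supports. No third layer will be filed: lemmas below the children ride with --supports.

CHEAPEST FALSIFIER. (1) Recompute with kit (minutes): relaxed LJ 12-6 lattice sums with the full r⁻⁶
tail — hcp must beat fcc and every Barlow polytype of
period ≤ 6 at zero pressure (Stillinger2001, LoachAckland2017 say yes, by ≈ 1e-4 relative); a
reversal kills the HCP clause of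
PalmRigidity / LayeredLawsSelectHcp as typed. (2) By hand (done at filing): the HCP Palm law
satisfies the typed constants — a* ≈ 0.971 ∈
[0.9, 1], h* ≈ 0.793 ∈ [1/2, 2], relaxed-shell distortion 3.7e-4 ≪ a/100, next shell √2·a* ≈ 1.373 >
5a/4, bond window (0, 1.12] separates
first-shell pairs (≤ 1.01) from all others (≥ 1.125). (3) Literature/crystallography lookup for
ShellsToBarlowChart: can two stacking faults on
non-parallel {111} planes meet without a stair-rod core (every junction atom 12-coordinated with a 1
%-perfect shell)?

NUMBERS. LJ normalisation V = r⁻¹²/12 − r⁻⁶/6, r₀ = 1, min −1/12; hard core of ground states δ = 1/3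
(LennardJonesMinimalDistance_holds); relaxed
hcp/fcc nearest-neighbour distance a* ≈ 0.9712 r₀ (= 1.0902 σ), interlayer spacing h* ≈ 0.793, c/a −
√(8/3) ≈ 3e-4; e_hcp − e_fcc ≈
−1e-4·|e*| (Stillinger2001); J₂ ≈ −7.3e−5, |J₂| / Σ_(k≥3) (k−1)|J_k| ∈ [287, 587] (route-internal
numerics of poisson-bessel-stacking-selection /
0670, uncertified); tolerances typed: shell 1/100·a, shell radius 5/4·a, scale a ∈ [9/10, 1], bond
window 28/25, parameter box [1/2, 2]².
Items at open: 13 (1 target, 3 cruxes, 8 support of which 4 shared — 0626, 0714, 2911, 2916 — and 1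
assembly); deciding theorem `closes` over 9 of them.

DEFINITION REQUESTS. To be filed after open (convenience, not load-bearing — every signature already
elaborates over Mathlib + tree):
IsPointStationaryLaw (Mecke mass-transport identity for laws on counting measures of ℝᵈ; topic
Literature/Probability/Process) and
rootEnergy V μ = ½ ∫ V(‖y‖) dμ (topic Literature/MathematicalPhysics/StatisticalMechanics). No cite
facts needed: Palm ⟺ point-stationary
(HevelingLast2005, LastThorisson2009) is used only as motivation; the statements quantify over the
Mecke identity directly.

Novelty: Searches (2026-08-15): `lit search --hybrid "unimodular point process energy minimizing Palm measure
crystallization ground state"`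
(12 docs: arXiv:2107.14020 lattice ground states, LastPenrose2017 ch. 9, point-process textbooks —
none joins Palm/unimodular limits to
LJ ground states); `lit search --source zbmath "Benjamini-Schramm limit point process energy
minimizers stationary Lennard-Jones"` (0);
`lit galaxy search "stationary point process minimizing energy crystallization" --star all` and
`"unimodular local limit ground states
energy per particle"` (galaxyd queue time-outs, 0 rows); `lit frontier AtomisticToContinuum --since
2020` (30 rows, none on point-process
formulations); plus the two refuter novelty audits of the cards (crossref/zbMATH sweeps,
2026-08-15).
Nearest prior art found: AldousSteele2004 + AldousLyons2007 (objective method: uniform rooting,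
exact MTP, lim cost_N/N = E[cost at root]);
Radin1987 / Radin1991 and doi:10.1007/s00454-002-2791-7 (Bowen–Radin 2003: optimisation over
invariant measures, ergodic decomposition,
measure optimum = classical optimum for packings); arXiv:2202.09240 (Lewin 2022, Def. 11 / Thm 12: T
= 0 stationary-process variational
characterisation for CONFINED Riesz gases); HevelingLast2005, LastThorisson2009 (point-stationarity
⟺ Palm).
Delta: the objective method applied to FREE zero-pressure LJ clusters with the Palm side first —
E(N)/N an exact expectation, both
Blanc–Lewin conjuncts collapsed into the classification of minimisers  [refs: 10.1007/s00454-002-2791-7, 2107.14020, 2202.09240, doi:10.1007/s00454-002-2791-7, LastPenrose2017, AldousSteele2004, AldousLyons2007, Radin1987, Radin1991, HevelingLast2005, LastThorisson2009]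

Barriers (technique_class: benjamini-schramm-limit palm-variational mass-transport): - technique_class: benjamini-schramm-limit palm-variational mass-transport
- Literature.Barriers.AtomisticToContinuum.SutoDegenerateGroundStates: a potential-generic
periodicity mechanism would be blocked; the framework proves no periodicity by itself — periodicity
enters only through the LJ-specific cruxes MinimiserShells (constants 9/10, 1/100, 5/4 are LJ's) and
LayeredLawsSelectHcp (sign and domination of LJ's Hägg couplings); for Sütő potentials the same
framework correctly returns a large face of minimisers.
- Literature.Barriers.AtomisticToContinuum.NoPeriodicGroundStateConfig: "local rules ⇒ periodic" is
never claimed; ShellsToBarlowChart concludes only a Barlow stacking with an ARBITRARY Hägg word, and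
the Wang-tile lattice gas would be reported as having aperiodic minimising measures.
- Literature.Barriers.AtomisticToContinuum.KissingTwelveDegeneracy: APPLIES to ShellsToBarlowChart's
conclusion (every Hägg walk is allowed); the stacking is selected in LayeredLawsSelectHcp by the r⁻⁶
tail acting beyond √(8/3)·a through the interlayer couplings J_k (0737/0670) — evasion (ii) of the
barrier; declared residual risk = certification of J_k.
- Literature.Barriers.AtomisticToContinuum.FlexibleKissingArrangements: APPLIES to any inference
from ONE 12-shell; evaded because MinimiserShells asks FCC/HCP-closeness as an ENERGETIC almost-sure
statement about minimising laws (not as a consequence of 12-coordination of one shell), and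
ShellsToBarlowChart assumes good shells at EVERY

Novelty grade: new-combination — REVIEW rreview-0815T13-14-0: PalmUnimodularRigidity = conforming re-filing of retired PalmUnimodularLimit (D-0027 technicality; not a recombination of closed routes). All signatures BYTE-IDENTICAL to 4075-4083 (+ shared 0626/0714/2911/2916), checked by >= 8 refuters 11:35-12:01Z on the built module  (refuter refuter-rreview-0815T13-14-0, 2026-08-15T14:29:25Z; prior: AldousLyons2007, LastThorisson2009, BlancLewin2015, arXiv:1705.01751, doi:10.1111/sapm.12533)

History (route lifecycle, newest last):
- 2026-08-26T06:31:04Z · DORMANT — reconciler: no traction for 8.4 d (last activity item-evidence-added at 2026-08-17T20:21:40Z); parked, not closed — `ledger route dormant route-AtomisticToConti (operator:999:134193)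

sub-problem: Crystallization · status: dormant · opened planner-plancard-AtomisticToContinuum-Crystal-27c31266-0 2026-08-15T13:52:51Z · rev 3 · ledger route-AtomisticToContinuum-PalmUnimodularRigidity
GENERATED by the gate from the ledger (D-0016/17). Provers cite these decls: `theorem foo : Summit.AtomisticToContinuum.Crystallization.Theses.PalmUnimodularRigidity.<Decl> := …` in Summits/AtomisticToContinuum/Crystallization/Theorems/<Name>.lean.
-/

namespace Summit.AtomisticToContinuum.Crystallization.Theses.PalmUnimodularRigidity

open scoped BigOperators Topology Manifold Classical MeasureTheory ProbabilityTheory Matrix InnerProductSpace ComplexConjugate ContinuousMap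
open Filter Set Function TopologicalSpace MeasureTheory

attribute [summit_statement] _root_.Crystallization

/-- item stmt-AtomisticToContinuum-9224 · target · rank 0 · open · by planner
why it might fail: False if some minimising point-stationary hard-core law is not relaxed HCP: needs hcp to be THE periodic LJ minimiser of R^3 (open even among Bravais lattices; fcc/polytype gaps ~1e-4, couplings 0670 uncertified) and minimisers to be close-packed at all (3-D crystallization open, Blanc-Lewin 2.3).
sources: BlancLewin2015, Stillinger2001, SchwerdtfegerBurrowsSmits2021, PartayOrtnerCsanyi2017, Radin1991, Radin1987
[target] X as in § Thesis: every minimising point-stationary hard-core probability law on rooted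
configurations of ℝ³ is almost surely a rotated relaxed HCP crystal count|A(hcpStacking a h), (a,h)
∈ [1/2,2]², with e(hcp a h) = e* (card items U1+U2 at the measure level). -/
@[route_item "route-AtomisticToContinuum-PalmUnimodularRigidity", crux]
def PalmRigidity : Prop :=
  ∀ δ : ℝ, 0 < δ → ∀ P : MeasureTheory.Measure (MeasureTheory.Measure (EuclideanSpace ℝ (Fin 3))), MeasureTheory.IsProbabilityMeasure P → (∀ᵐ μ ∂P, (∃ S : Set (EuclideanSpace ℝ (Fin 3)), (0 : EuclideanSpace ℝ (Fin 3)) ∈ S ∧ (∀ x ∈ S, ∀ y ∈ S, x ≠ y → δ ≤ dist x y) ∧ μ = (MeasureTheory.Measure.count : MeasureTheory.Measure (EuclideanSpace ℝ (Fin 3))).restrict S)) → (∀ g : MeasureTheory.Measure (EuclideanSpace ℝ (Fin 3)) → EuclideanSpace ℝ (Fin 3) → ENNReal, Measurable (Function.uncurry g) → ∫⁻ μ, ∫⁻ y, g μ y ∂μ ∂P = ∫⁻ μ, ∫⁻ y, g (MeasureTheory.Measure.map (fun z => z - y) μ) (-y) ∂μ ∂P) → (∫ μ, (∫ y, Literature.MathematicalPhysics.StatisticalMechanics.lennardJones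 ‖y‖ ∂μ) / 2 ∂P) ≤ (⨅ Q : Literature.MathematicalPhysics.StatisticalMechanics.PeriodicConfiguration 3, Q.energyPerParticle Literature.MathematicalPhysics.StatisticalMechanics.lennardJones) → ∀ᵐ μ ∂P, (∃ a h : ℝ, ∃ ha : a ≠ 0, ∃ hh : h ≠ 0, 1 / 2 ≤ a ∧ a ≤ 2 ∧ 1 / 2 ≤ h ∧ h ≤ 2 ∧ ∃ A : EuclideanSpace ℝ (Fin 3) ≃ₗᵢ[ℝ] EuclideanSpace ℝ (Fin 3), (Literature.MathematicalPhysics.StatisticalMechanics.hcpPeriodicConfiguration ha hh).energyPerParticle Literature.MathematicalPhysics.StatisticalMechanics.lennardJones = (⨅ Q : Literature.MathematicalPhysics.StatisticalMechanics.PeriodicConfiguration 3, Q.energyPerParticle Literature.MathematicalPhysics.StatisticalMechanics.lennardJones) ∧ μ = (MeasureTheory.Measure.count : MeasureTheory.Measure (EuclideanSpace ℝ (Fin 3))).restrict (A '' Literature.MathematicalPhysics.StatisticalMechanics.hcpStacking a h))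

/-- item stmt-AtomisticToContinuum-9225 · crux · rank 2 · open · by planner
why it might fail: No local energy inequality forcing close-packed shells is known for pair LJ in d=3 (Flatley-Theil 2015 need a 3-body term, Conj. 2.2 open; Blanc-Lewin 2.3): a minimising point-stationary law with polytetrahedral/Frank-Kasper or D5h root shells (cf. negatives 4146, 0.67% strain < 1%) refutes it.
sources: BlancLewin2015, FlatleyTheil2015, Theil2006, Hales2012, Stillinger2001, FrankKasper1958
[crux] MEASURE-LEVEL LOCAL STRUCTURE (card U1): for every δ > 0 and every point-stationary hard-core
probability law P with E_P[h] ≤ e*, P-a.s. the root has a close-packed first shell: there is a scale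
a ∈ [9/10, 1] such that the configuration points y ≠ 0 with ‖y‖ ≤ 5a/4 are exactly twelve and, after
a rotation, (a/100)-matched to the a-scaled FCC (cuboctahedron) or HCP (anticuboctahedron) kissing
pattern (`ShellCloseTo`). By unimodularity the same then holds at every point. The frustration crux:
at the measure level it is an expectation inequality E_P[h] ≥ e* + c·P(bad root shell) over
point-stationary laws, where mass-transport / Mecke identities of the typical Delaunay star are
available as exact linear constraints. [difficulty: open-problem] -/
@[route_item "route-AtomisticToContinuum-PalmUnimodularRigidity", crux]
def MinimiserShells : Prop :=
  ∀ δ : ℝ, 0 < δ → ∀ P : MeasureTheory.Measure (MeasureTheory.Measure (EuclideanSpace ℝ (Fin 3))), MeasureTheory.IsProbabilityMeasure P → (∀ᵐ μ ∂P, (∃ S : Set (EuclideanSpace ℝ (Fin 3)), (0 : EuclideanSpace ℝ (Fin 3)) ∈ S ∧ (∀ x ∈ S, ∀ y ∈ S, x ≠ y → δ ≤ dist x y) ∧ μ = (MeasureTheory.Measure.count : MeasureTheory.Measure (EuclideanSpace ℝ (Fin 3))).restrict S)) → (∀ g : MeasureTheory.Measure (EuclideanSpace ℝ (Fin 3)) →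 EuclideanSpace ℝ (Fin 3) → ENNReal, Measurable (Function.uncurry g) → ∫⁻ μ, ∫⁻ y, g μ y ∂μ ∂P = ∫⁻ μ, ∫⁻ y, g (MeasureTheory.Measure.map (fun z => z - y) μ) (-y) ∂μ ∂P) → (∫ μ, (∫ y, Literature.MathematicalPhysics.StatisticalMechanics.lennardJones ‖y‖ ∂μ) / 2 ∂P) ≤ (⨅ Q : Literature.MathematicalPhysics.StatisticalMechanics.PeriodicConfiguration 3, Q.energyPerParticle Literature.MathematicalPhysics.StatisticalMechanics.lennardJones) → ∀ᵐ μ ∂P, (∃ a : ℝ, 9 / 10 ≤ a ∧ a ≤ 1 ∧ ∃ T : Finset (EuclideanSpace ℝ (Fin 3)), (↑T : Set (EuclideanSpace ℝ (Fin 3))) = {y : EuclideanSpace ℝ (Fin 3) | μ {y} ≠ 0 ∧ y ≠ 0 ∧ ‖y‖ ≤ 5 / 4 * a} ∧ (Literature.Geometry.DiscreteGeometry.ShellCloseTo (a / 100) T (Finset.image (fun v : EuclideanSpace ℝ (Fin 3) => a • v) Literature.Geometry.DiscreteGeometry.fccKissingPattern) ∨ Literature.Geometry.DiscreteGeometry.ShellCloseTo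 (a / 100) T (Finset.image (fun v : EuclideanSpace ℝ (Fin 3) => a • v) Literature.Geometry.DiscreteGeometry.hcpKissingPattern)))

/-- item stmt-AtomisticToContinuum-9226 · crux · rank 3 · open · by planner
why it might fail: Needs e(hcp)<e(fcc) AND hcp below every Barlow polytype for the full r^-6 tail: margin ~1e-4|e*| (Stillinger 2001; Schwerdtfeger+ 2021), polytypes win at the fcc/hcp boundary under truncation (Partay+ 2017), couplings 0670 uncertified; plus strict elastic/phonon rigidity of relaxed hcp in a 1% tube.
sources: Stillinger2001, SchwerdtfegerBurrowsSmits2021, PartayOrtnerCsanyi2017, LoachAckland2017, stmt-AtomisticToContinuum-0670, stmt-AtomisticToContinuum-0737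
[crux] SELECTION AND RIGIDITY IN DENSITY FORM (card U2 + elastic rigidity): a minimising
point-stationary hard-core law that is a.s. carried by configurations S all of whose points have
(1/100)-close-packed shells AND which are globally bond-isomorphic to an ideal Barlow stacking (a
bijection Φ from barlowStacking 1 √(2/3) s, s a Hägg sequence, onto S with ideal contacts ↔ pairs at
distance in (0, 28/25]) is a.s. an exact rotated relaxed HCP crystal with optimal parameters: μ =
count|A(hcpStacking a h), e(hcp a h) = e*. Mechanism: linearity of E_P[h] + Hägg domination (0737
with the couplings of 0670) give fault density 0, hence no faults a.s. for ergodic components;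
harmonic + anharmonic stability of relaxed hcp in the 1 % tube kills the displacement field; e(hcp a
h) ≥ e* ≥ E_P[h] pins (a,h). [deps: ShellsToBarlowChart] [difficulty: XL] -/
@[route_item "route-AtomisticToContinuum-PalmUnimodularRigidity", crux]
def LayeredLawsSelectHcp : Prop :=
  ∀ δ : ℝ, 0 < δ → ∀ P : MeasureTheory.Measure (MeasureTheory.Measure (EuclideanSpace ℝ (Fin 3))), MeasureTheory.IsProbabilityMeasure P → (∀ᵐ μ ∂P, (∃ S : Set (EuclideanSpace ℝ (Fin 3)), (0 : EuclideanSpace ℝ (Fin 3)) ∈ S ∧ (∀ x ∈ S, ∀ y ∈ S, x ≠ y → δ ≤ dist x y) ∧ μ = (MeasureTheory.Measure.count : MeasureTheory.Measure (EuclideanSpace ℝ (Fin 3))).restrict S)) → (∀ g : MeasureTheory.Measure (EuclideanSpace ℝ (Fin 3)) → EuclideanSpace ℝ (Fin 3) → ENNReal, Measurable (Function.uncurry g) → ∫⁻ μ, ∫⁻ y, g μ y ∂μ ∂P = ∫⁻ μ, ∫⁻ y, g (MeasureTheory.Measure.map (fun z => z - y) μ) (-y) ∂μ ∂P) → (∫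 μ, (∫ y, Literature.MathematicalPhysics.StatisticalMechanics.lennardJones ‖y‖ ∂μ) / 2 ∂P) ≤ (⨅ Q : Literature.MathematicalPhysics.StatisticalMechanics.PeriodicConfiguration 3, Q.energyPerParticle Literature.MathematicalPhysics.StatisticalMechanics.lennardJones) → (∀ᵐ μ ∂P, ∃ S : Set (EuclideanSpace ℝ (Fin 3)), μ = (MeasureTheory.Measure.count : MeasureTheory.Measure (EuclideanSpace ℝ (Fin 3))).restrict S ∧ (∀ x ∈ S, (∃ a : ℝ, 9 / 10 ≤ a ∧ a ≤ 1 ∧ ∃ T : Finset (EuclideanSpace ℝ (Fin 3)), (↑T : Set (EuclideanSpace ℝ (Fin 3))) = (fun y : EuclideanSpace ℝ (Fin 3) => y - x) '' {y : EuclideanSpace ℝ (Fin 3) | y ∈ S ∧ y ≠ x ∧ dist y x ≤ 5 / 4 * a} ∧ (Literature.Geometry.DiscreteGeometry.ShellCloseTo (a / 100) T (Finset.image (fun v : EuclideanSpace ℝ (Fin 3) => a • v) Literature.Geometry.DiscreteGeometry.fccKissingPattern) ∨ Literature.Geometry.DiscreteGeometry.ShellCloseTo (a / 100) T (Finset.image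 (fun v : EuclideanSpace ℝ (Fin 3) => a • v) Literature.Geometry.DiscreteGeometry.hcpKissingPattern)))) ∧ (∃ s : ℤ → ℤ, Literature.MathematicalPhysics.StatisticalMechanics.IsHaggSeq s ∧ ∃ Φ : EuclideanSpace ℝ (Fin 3) → EuclideanSpace ℝ (Fin 3), Set.BijOn Φ (Literature.MathematicalPhysics.StatisticalMechanics.barlowStacking 1 (Real.sqrt (2 / 3)) s) S ∧ ∀ p ∈ Literature.MathematicalPhysics.StatisticalMechanics.barlowStacking 1 (Real.sqrt (2 / 3)) s, ∀ q ∈ Literature.MathematicalPhysics.StatisticalMechanics.barlowStacking 1 (Real.sqrt (2 / 3)) s, (dist p q = 1 ↔ (0 < dist (Φ p) (Φ q) ∧ dist (Φ p) (Φ q) ≤ 28 / 25)))) → ∀ᵐ μ ∂P, (∃ a h : ℝ, ∃ ha : a ≠ 0, ∃ hh : h ≠ 0, 1 / 2 ≤ a ∧ a ≤ 2 ∧ 1 / 2 ≤ h ∧ h ≤ 2 ∧ ∃ A : EuclideanSpace ℝ (Fin 3) ≃ₗᵢ[ℝ] EuclideanSpace ℝ (Fin 3), (Literature.MathematicalPhysics.StatisticalMechanics.hcpPeriodicConfiguration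 ha hh).energyPerParticle Literature.MathematicalPhysics.StatisticalMechanics.lennardJones = (⨅ Q : Literature.MathematicalPhysics.StatisticalMechanics.PeriodicConfiguration 3, Q.energyPerParticle Literature.MathematicalPhysics.StatisticalMechanics.lennardJones) ∧ μ = (MeasureTheory.Measure.count : MeasureTheory.Measure (EuclideanSpace ℝ (Fin 3))).restrict (A '' Literature.MathematicalPhysics.StatisticalMechanics.hcpStacking a h))

/-- item stmt-AtomisticToContinuum-9227 · crux · rank 4 · closed · proved by Summit.AtomisticToContinuum.Crystallization.Cruxes.ShellsToBarlowChart.DevelopTheModelGrowthDescent.ShellsToBarlowChart_of @ 4ba081aa6f4f (prover) · by planner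
why it might fail: Exact case proved only (Hales DSP 1.3; Boroczky-Szabo 2015; in tree). Boroczky-Szabo 2016 build eps-quasi-12-neighbour packings with surprising properties for all eps>0; the metric propagation steps (coplanarity, no room for extra balls) must survive 1% shells or a non-layered all-good set exists.
sources: HalesDSP2012, Hales2012, BoroczkySzabo2015, BoroczkySzabo2016, FlatleyTheil2015, KusnerKusnerLagariasShlosman2018
[crux] ROBUST LAYER THEOREM (pure geometry, no potential, no measure): a non-empty set S ⊂ ℝ³ in
which EVERY point x has a (1/100)-close-packed first shell at its own scale a_x ∈ [9/10, 1] (twelve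
points within 5a_x/4, matched after rotation to the a_x-scaled FCC or HCP pattern, nothing else that
close) is globally bond-isomorphic to an ideal Barlow stacking: there are a Hägg sequence s and a
bijection Φ : barlowStacking 1 √(2/3) s → S with dist p q = 1 ↔ 0 < dist (Φ p) (Φ q) ≤ 28/25. The
exact case (slack 0, conclusion a congruence) is Hales, Dense Sphere Packings §1.3, proved in tree
as HalesDSP_layerPackings_holds; metric closeness is NOT claimed globally (slow elastic drift is
allowed), only the combinatorics. [difficulty: L] -/
@[route_item "route-AtomisticToContinuum-PalmUnimodularRigidity", crux]
def ShellsToBarlowChart : Prop :=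
  ∀ S : Set (EuclideanSpace ℝ (Fin 3)), S.Nonempty → (∀ x ∈ S, (∃ a : ℝ, 9 / 10 ≤ a ∧ a ≤ 1 ∧ ∃ T : Finset (EuclideanSpace ℝ (Fin 3)), (↑T : Set (EuclideanSpace ℝ (Fin 3))) = (fun y : EuclideanSpace ℝ (Fin 3) => y - x) '' {y : EuclideanSpace ℝ (Fin 3) | y ∈ S ∧ y ≠ x ∧ dist y x ≤ 5 / 4 * a} ∧ (Literature.Geometry.DiscreteGeometry.ShellCloseTo (a / 100) T (Finset.image (fun v : EuclideanSpace ℝ (Fin 3) => a • v) Literature.Geometry.DiscreteGeometry.fccKissingPattern) ∨ Literature.Geometry.DiscreteGeometry.ShellCloseTo (a / 100) T (Finset.image (fun v : EuclideanSpace ℝ (Fin 3) => a • v) Literature.Geometry.DiscreteGeometry.hcpKissingPattern)))) → (∃ s : ℤ → ℤ, Literature.MathematicalPhysics.StatisticalMechanics.IsHaggSeq s ∧ ∃ Φ : EuclideanSpace ℝ (Fin 3) → EuclideanSpace ℝ (Fin 3), Set.BijOn Φ (Literature.MathematicalPhysics.StatisticalMechanics.barlowStacking 1 (Real.sqrt (2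 / 3)) s) S ∧ ∀ p ∈ Literature.MathematicalPhysics.StatisticalMechanics.barlowStacking 1 (Real.sqrt (2 / 3)) s, ∀ q ∈ Literature.MathematicalPhysics.StatisticalMechanics.barlowStacking 1 (Real.sqrt (2 / 3)) s, (dist p q = 1 ↔ (0 < dist (Φ p) (Φ q) ∧ dist (Φ p) (Φ q) ≤ 28 / 25)))

-- `ShellsToBarlowChart` holds: proved by `Summit.AtomisticToContinuum.Crystallization.Cruxes.ShellsToBarlowChart.DevelopTheModelGrowthDescent.ShellsToBarlowChart_of` @ 4ba081aa6f4f (its module imports this route file, so no `_holds` link can be stated here).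

/-- item stmt-AtomisticToContinuum-0626 · support · rank 9 · closed · proved by Summit.AtomisticToContinuum.Crystallization.Theorems.crysEnergyLimit_proof @ de27d46e58f4 (prover) · by planner
sources: BlancLewin2015, stmt-AtomisticToContinuum-0626
Energetic crystallization: E(N)/N converges to the infimum over periodic (multi-lattice)
configurations of the LJ energy per particle in d = 3. Lower bound liminf ≥ ⨅ is the content ((a)
local optimality + (d) + surface term O(N^{2/3})); upper bound is filed separately. -/
@[route_item "route-AtomisticToContinuum-PalmUnimodularRigidity", crux]
def CrysEnergyLimit : Prop :=
  Filter.Tendsto (fun N : ℕ => Literature.MathematicalPhysics.StatisticalMechanics.groundStateEnergy Literature.MathematicalPhysics.StatisticalMechanics.lennardJones 3 N / N) Filter.atTop (nhds (⨅ Q : Literature.MathematicalPhysics.StatisticalMechanics.PeriodicConfiguration 3, Q.energyPerParticle Literature.MathematicalPhysics.StatisticalMechanics.lennardJones))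

/-- `CrysEnergyLimit` holds: proved by `Summit.AtomisticToContinuum.Crystallization.Theorems.crysEnergyLimit_proof` @ de27d46e58f4. -/
theorem CrysEnergyLimit_holds : CrysEnergyLimit := _root_.Summit.AtomisticToContinuum.Crystallization.Theorems.crysEnergyLimit_proof

/-- item stmt-AtomisticToContinuum-0714 · support · rank 9 · closed · proved by Summit.AtomisticToContinuum.Crystallization.Theorems.crysPeriodicBddBelow_proof (prover) · by planner
sources: BlancLewin2015, stmt-AtomisticToContinuum-0714
The Lennard-Jones energy per particle of periodic configurations of ℝ³ (any full-rank lattice, any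
finite motif) is bounded below (by −B, the stability constant: finite blocks of Q as N-point
configurations, boundary O(N^{2/3}), r⁻⁶ tail summable in d = 3). Makes ⨅_Q e(Q) a genuine infimum
(ciInf_le usable) in 0626/0629 and in the periodisation lemma. -/
@[route_item "route-AtomisticToContinuum-PalmUnimodularRigidity", crux]
def CrysPeriodicBddBelow : Prop :=
  BddBelow (Set.range fun Q : Literature.MathematicalPhysics.StatisticalMechanics.PeriodicConfiguration 3 => Q.energyPerParticle Literature.MathematicalPhysics.StatisticalMechanics.lennardJones)

-- `CrysPeriodicBddBelow` holds: proved by `Summit.AtomisticToContinuum.Crystallization.Theorems.crysPeriodicBddBelow_proof` (its module imports this route file, so no `_holds` link can be stated here).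

/-- item stmt-AtomisticToContinuum-2911 · support · rank 9 · open · by planner
sources: BlancLewin2015, stmt-AtomisticToContinuum-2911, AldousSteele2004
[crux] (finite-N hinge; deterministic shadow of "the Benjamini–Schramm limit of the ground states
charges Q") for every sequence of LJ ground states x^N in ℝ³ there is ONE periodic configuration Q
such that for all R, ε > 0 there is ρ > 0 with, for infinitely many N, at least ρN particles i whose
R-neighbourhood x^N ∩ B_R(x_i) is ε-matched both ways with x_i + A(Q.points − q) for some linear
isometry A and some base point q ∈ Q.points (base point in Q.points, not a fixed origin: no
vertex-transitivity is forced, cf. refuter note on 0751). Weaker than BulkDefectVanish 0751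
(fraction → 1, fixed HCP): positive density, frequently in N, any periodic Q. [deps:
StationaryMinimisersChargePeriodic, NoFoam] [difficulty: XL] -/
@[route_item "route-AtomisticToContinuum-PalmUnimodularRigidity"]
def GroundStatesChargePeriodic : Prop :=
  ∀ x : (N : ℕ) → (Fin N → EuclideanSpace ℝ (Fin 3)), (∀ N, Literature.MathematicalPhysics.StatisticalMechanics.IsGroundState Literature.MathematicalPhysics.StatisticalMechanics.lennardJones (x N)) → ∃ Q : Literature.MathematicalPhysics.StatisticalMechanics.PeriodicConfiguration 3, ∀ R ε : ℝ, 0 < R → 0 < ε → ∃ ρ : ℝ, 0 < ρ ∧ ∃ᶠ N : ℕ in Filter.atTop, ρ * (N : ℝ) ≤ (Nat.card {i : Fin N // ∃ A : EuclideanSpace ℝ (Fin 3) →ₗᵢ[ℝ] EuclideanSpace ℝ (Fin 3), ∃ q ∈ Q.points, (∀ s ∈ Q.points, dist s q ≤ R → ∃ j : Fin N, dist (x N j) (x N i + A (s - q)) ≤ ε) ∧ (∀ j : Fin N, dist (x N j) (x N i) ≤ R → ∃ s ∈ Q.points, dist (x N j) (x N i + A (s - q)) ≤ ε)} : ℝ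)

/-- item stmt-AtomisticToContinuum-2916 · support · rank 9 · closed · proved by Summit.AtomisticToContinuum.Crystallization.Theorems.chargedPatternCrystallizes_proof (prover) · by planner
sources: BlancLewin2015, stmt-AtomisticToContinuum-2916
[support] (soft) GroundStatesChargePeriodic → LennardJonesMinimalDistance → IsCrystallizing
lennardJones 3: choose scales (k, 1/k), indices N_k ↑ with a good particle i_k, isometries A_k → A
along a subsequence (compactness of O(3)), τ_k := −x_(i_k) + alignment; the two-way matching with
minimal distance is eventually exact near every compact set, so
PeriodicConfiguration.tendsto_sum_of_eventually_near' (in tree) gives local convergence to the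
periodic configuration A(Q − q) (isometryImage/translate in CrystallizationSymmetries), multiplicity
1. [difficulty: M] -/
@[route_item "route-AtomisticToContinuum-PalmUnimodularRigidity", crux]
def ChargedPatternCrystallizes : Prop :=
  GroundStatesChargePeriodic → Literature.MathematicalPhysics.StatisticalMechanics.LennardJonesMinimalDistance → Literature.MathematicalPhysics.StatisticalMechanics.IsCrystallizing Literature.MathematicalPhysics.StatisticalMechanics.lennardJones 3

-- `ChargedPatternCrystallizes` holds: proved by `Summit.AtomisticToContinuum.Crystallization.Theorems.chargedPatternCrystallizes_proof` (its module imports this route file, so no `_holds` link can be stated here).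

/-- item stmt-AtomisticToContinuum-9228 · support · rank 9 · closed · proved by Summit.AtomisticToContinuum.Crystallization.Theorems.PalmUnimodularRigidity.cruxesToPalmRigidity_proof (prover) · by planner
sources: AldousLyons2007, LastThorisson2009
[support] glue of the foreseen decomposition of the target: MinimiserShells → ShellsToBarlowChart →
LayeredLawsSelectHcp → PalmRigidity. Content: the unimodular "root a.s. ⇒ every point a.s." lemma
(mass transport with g(μ,y) = 1[shell at y bad]) and the identification of the points of count|S
shifted by −x with S − x; measurability of the shell event is the Lean cost. [difficulty: M] -/
@[route_item "route-AtomisticToContinuum-PalmUnimodularRigidity", crux]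
def CruxesToPalmRigidity : Prop :=
  MinimiserShells → ShellsToBarlowChart → LayeredLawsSelectHcp → PalmRigidity

-- `CruxesToPalmRigidity` holds: proved by `Summit.AtomisticToContinuum.Crystallization.Theorems.PalmUnimodularRigidity.cruxesToPalmRigidity_proof` (its module imports this route file, so no `_holds` link can be stated here).

/-- item stmt-AtomisticToContinuum-9229 · support · rank 9 · closed · proved by Summit.AtomisticToContinuum.Crystallization.Theorems.unimodularEnergyLowerBound_proof (prover) · by planner
sources: LastThorisson2009, stmt-AtomisticToContinuum-0715, doi:10.1007/s00454-002-2791-7, Radin1991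
[support] e_uni ≥ e* (card A2, NO intensity / NoFoam hypothesis): every point-stationary hard-core
probability law has E_P[h] ≥ e* = ⨅ periodic e(Q). Proof sketch: adjoin an independent uniform phase
U of the grid Lℤ³ (the marked law stays unimodular); transport (h_y − e*)/n_cell from each point y
to the points of its grid cell; mass received at the root = (Σ_cell h_y − n e*)/n ≥ −C·n_∂/n − ε(R₀)
by E(n) ≥ n e* (periodisation, 0715) and the r^-6 tail; and E[n_∂/n] = P(root within R₀ of its cell
boundary) = O(R₀/L) by a second mass transport. Hence minimising laws have E_P[h] = e* exactly.
[difficulty: L] -/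
@[route_item "route-AtomisticToContinuum-PalmUnimodularRigidity"]
def UnimodularEnergyLowerBound : Prop :=
  ∀ δ : ℝ, 0 < δ → ∀ P : MeasureTheory.Measure (MeasureTheory.Measure (EuclideanSpace ℝ (Fin 3))), MeasureTheory.IsProbabilityMeasure P → (∀ᵐ μ ∂P, (∃ S : Set (EuclideanSpace ℝ (Fin 3)), (0 : EuclideanSpace ℝ (Fin 3)) ∈ S ∧ (∀ x ∈ S, ∀ y ∈ S, x ≠ y → δ ≤ dist x y) ∧ μ = (MeasureTheory.Measure.count : MeasureTheory.Measure (EuclideanSpace ℝ (Fin 3))).restrict S)) → (∀ g : MeasureTheory.Measure (EuclideanSpace ℝ (Fin 3)) → EuclideanSpace ℝ (Fin 3) → ENNReal, Measurable (Function.uncurry g) → ∫⁻ μ, ∫⁻ y, g μ y ∂μ ∂P = ∫⁻ μ, ∫⁻ y, g (MeasureTheory.Measure.map (fun z => z - y) μ) (-y) ∂μ ∂P) → (⨅ Q : Literature.MathematicalPhysics.StatisticalMechanics.PeriodicConfiguration 3, Q.energyPerParticle Literature.MathematicalPhysics.StatisticalMechanics.lennardJones) ≤ (∫ μ, (∫ y,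 Literature.MathematicalPhysics.StatisticalMechanics.lennardJones ‖y‖ ∂μ) / 2 ∂P)

-- `UnimodularEnergyLowerBound` holds: proved by `Summit.AtomisticToContinuum.Crystallization.Theorems.unimodularEnergyLowerBound_proof` (its module imports this route file, so no `_holds` link can be stated here).

/-- item stmt-AtomisticToContinuum-9230 · support · rank 9 · closed · proved by Summit.AtomisticToContinuum.Crystallization.Theorems.benjaminiSchrammLimit_proof_periodicSupport @ fd567f870798 (prover) · by planner
sources: AldousLyons2007, AldousSteele2004, LastPenrose2017, BlancLewin2015, HevelingLast2005
[support] CONSTRUCTION (card U3; existence kept separate from the interface): for every sequence of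
LJ ground states x^N there are a subsequence φ, a hard core δ > 0 and a probability law P on rooted
δ-separated configurations which is point-stationary, has E_P[h] = lim_j E(φ j)/φ j (stated as
Tendsto), and is a LOCAL LIMIT in the density-transfer (portmanteau) form the assembly uses: for
every set T of configurations, every R, ε > 0 and every ρ < P(T), for all large j at least ρ·φ(j)
particles i of x^(φ j) have their recentred configuration (R, ε)-matched (both ways, inside the ball
of radius R) to some ν ∈ T. Proof: P_N := (1/N) Σ_i δ_(count|(x^N − x_i)); mass transport is an
exact finite identity; E_(P_N)[h] = E(N)/N; compactness of rooted (1/3)-separated configurations in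
the local topology (LennardJonesMinimalDistance_holds); h is a uniform limit of bounded local
continuous functionals (tail ≤ C R^-3); unimodularity passes to the limit; transfer by Skorokhod /
portmanteau with open fattenings. [difficulty: XL] -/
@[route_item "route-AtomisticToContinuum-PalmUnimodularRigidity", crux]
def BenjaminiSchrammLimit : Prop :=
  ∀ x : (N : ℕ) → (Fin N → EuclideanSpace ℝ (Fin 3)), (∀ N, Literature.MathematicalPhysics.StatisticalMechanics.IsGroundState Literature.MathematicalPhysics.StatisticalMechanics.lennardJones (x N)) → ∃ φ : ℕ → ℕ, StrictMono φ ∧ ∃ δ : ℝ, 0 < δ ∧ ∃ P : MeasureTheory.Measure (MeasureTheory.Measure (EuclideanSpace ℝ (Fin 3))), MeasureTheory.IsProbabilityMeasure P ∧ (∀ᵐ μ ∂P, (∃ S : Set (EuclideanSpace ℝ (Fin 3)), (0 : EuclideanSpace ℝ (Fin 3)) ∈ S ∧ (∀ x ∈ S, ∀ y ∈ S, x ≠ y → δ ≤ dist x y) ∧ μ = (MeasureTheory.Measure.count : MeasureTheory.Measure (EuclideanSpace ℝ (Fin 3))).restrict S)) ∧ (∀ g : MeasureTheory.Measure (EuclideanSpace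 ℝ (Fin 3)) → EuclideanSpace ℝ (Fin 3) → ENNReal, Measurable (Function.uncurry g) → ∫⁻ μ, ∫⁻ y, g μ y ∂μ ∂P = ∫⁻ μ, ∫⁻ y, g (MeasureTheory.Measure.map (fun z => z - y) μ) (-y) ∂μ ∂P) ∧ Filter.Tendsto (fun j : ℕ => Literature.MathematicalPhysics.StatisticalMechanics.groundStateEnergy Literature.MathematicalPhysics.StatisticalMechanics.lennardJones 3 (φ j) / (φ j : ℝ)) Filter.atTop (nhds (∫ μ, (∫ y, Literature.MathematicalPhysics.StatisticalMechanics.lennardJones ‖y‖ ∂μ) / 2 ∂P)) ∧ ∀ T : Set (MeasureTheory.Measure (EuclideanSpace ℝ (Fin 3))), ∀ R ε : ℝ, 0 < ε → ∀ ρ : ℝ, ρ < (P T).toReal → ∀ᶠ j : ℕ in Filter.atTop, ρ * (φ j : ℝ) ≤ (Nat.card {i : Fin (φ j) // ∃ ν ∈ T, ((∀ p : EuclideanSpace ℝ (Fin 3), ν {p} ≠ 0 → ‖p‖ ≤ R → ∃ q ∈ (Set.range (fun k : Fin (φ j) => x (φ j) k - x (φ j) i)), dist q p ≤ ε) ∧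 (∀ q ∈ (Set.range (fun k : Fin (φ j) => x (φ j) k - x (φ j) i)), ‖q‖ ≤ R → ∃ p : EuclideanSpace ℝ (Fin 3), ν {p} ≠ 0 ∧ dist q p ≤ ε))} : ℝ)

-- `BenjaminiSchrammLimit` holds: proved by `Summit.AtomisticToContinuum.Crystallization.Theorems.benjaminiSchrammLimit_proof_periodicSupport` @ fd567f870798 (its module imports this route file, so no `_holds` link can be stated here).

/-- item stmt-AtomisticToContinuum-9231 · support · rank 9 · closed · proved by Summit.AtomisticToContinuum.Crystallization.Theorems.PalmUnimodularRigidity.palmToHinge_proof (prover) · by planner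
sources: AldousLyons2007, stmt-AtomisticToContinuum-2911
[support] glue from the target to the SHARED finite-N hinge of route BenjaminiSchrammGroundStates:
PalmRigidity → BenjaminiSchrammLimit → CrysEnergyLimit → GroundStatesChargePeriodic (item 2911: ONE
periodic Q charged with positive density at every scale, frequently in N). Proof: the
Benjamini–Schramm limit P of the given sequence is minimising (CrysEnergyLimit), hence a.s. rotated
relaxed HCP (PalmRigidity); pick (a, h) in the topological support of the (a, h)-marginal (compact
box), Q := hcpPeriodicConfiguration a h, q := 0; configurations hcp(a′, h′) with |a′ − a|, |h′ − h|
≤ ε/(C R) are (R, ε/2)-close to hcp(a, h) index by index, so T := such configurations has P(T) > 0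
and the density transfer gives ≥ ρ N matched particles with ρ = P(T)/2. No NoFoam, no Palm
inversion. [difficulty: M] -/
@[route_item "route-AtomisticToContinuum-PalmUnimodularRigidity", crux]
def PalmToHinge : Prop :=
  PalmRigidity → BenjaminiSchrammLimit → CrysEnergyLimit → GroundStatesChargePeriodic

-- `PalmToHinge` holds: proved by `Summit.AtomisticToContinuum.Crystallization.Theorems.PalmUnimodularRigidity.palmToHinge_proof` (its module imports this route file, so no `_holds` link can be stated here).

/-- item stmt-AtomisticToContinuum-9232 · assembly · rank 1 · closed · proved by Summit.AtomisticToContinuum.Crystallization.Theorems.palmUnimodularRigidity_assembly_proof @ 20a055b94c44 (prover) · by planner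
sources: BlancLewin2015, AldousLyons2007
[assembly] MinimiserShells → ShellsToBarlowChart → LayeredLawsSelectHcp → CruxesToPalmRigidity →
BenjaminiSchrammLimit → PalmToHinge → ChargedPatternCrystallizes → CrysEnergyLimit →
CrysPeriodicBddBelow → Crystallization (the sub-problem decl `_root_.Crystallization`). -/
@[route_item "route-AtomisticToContinuum-PalmUnimodularRigidity"]
def Assembly : Prop :=
  MinimiserShells → ShellsToBarlowChart → LayeredLawsSelectHcp → CruxesToPalmRigidity → BenjaminiSchrammLimit → PalmToHinge → ChargedPatternCrystallizes → CrysEnergyLimit → CrysPeriodicBddBelow → Crystallization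

-- `Assembly` holds: proved by `Summit.AtomisticToContinuum.Crystallization.Theorems.palmUnimodularRigidity_assembly_proof` @ 20a055b94c44 (its module imports this route file, so no `_holds` link can be stated here).

/-! D-0027 §2.1 — DECIDING THEOREM (planner-authored via `route open/edit --closes-file`; by planner-rrepair-AtomisticToContinuum-PalmUnimo-fdbaadc6-g2-0 2026-08-15T16:32:07Z):
its hypotheses are this route's items and its conclusion the sub-problem Statement (glue_lint), and it elaborates with this file. -/

@[closes "route-AtomisticToContinuum-PalmUnimodularRigidity"] theorem closes : MinimiserShells → ShellsToBarlowChart → LayeredLawsSelectHcp → CruxesToPalmRigidity →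
    BenjaminiSchrammLimit → PalmToHinge → ChargedPatternCrystallizes → CrysEnergyLimit → CrysPeriodicBddBelow →
    _root_.Crystallization := by
  intro hShells hChart hSelect hGlue hBS hHinge hCharged hLim hBdd
  -- the three cruxes and their glue give the target X = PalmRigidity
  have hPalm : PalmRigidity := hGlue hShells hChart hSelect
  change Literature.MathematicalPhysics.StatisticalMechanics.HasPeriodicGroundStateEnergy
      Literature.MathematicalPhysics.StatisticalMechanics.lennardJones 3 ∧
    Literature.MathematicalPhysics.StatisticalMechanics.IsCrystallizing
      Literature.MathematicalPhysics.StatisticalMechanics.lennardJones 3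
  refine ⟨?_, ?_⟩
  · -- conjunct (i): the periodic minimum is attained (by relaxed HCP) and E(N)/N converges to it
    choose x hx using
      Literature.MathematicalPhysics.StatisticalMechanics.LennardJonesGroundStatesExist_holds
    obtain ⟨φ, hφ, δ, hδ, P, hP, hcore, hstat, hE, -⟩ := hBS x hx
    have h1 : Tendsto (fun j : ℕ =>
        Literature.MathematicalPhysics.StatisticalMechanics.groundStateEnergy
          Literature.MathematicalPhysics.StatisticalMechanics.lennardJones 3 (φ j) / (φ j : ℝ))
        atTop (𝓝 (⨅ Q : Literature.MathematicalPhysics.StatisticalMechanics.PeriodicConfiguration 3,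
          Q.energyPerParticle Literature.MathematicalPhysics.StatisticalMechanics.lennardJones)) :=
      hLim.comp hφ.tendsto_atTop
    have hEq := tendsto_nhds_unique hE h1
    haveI := hP
    obtain ⟨μ, a, h, ha, hh, -, -, -, -, A, hAe, -⟩ := (hPalm δ hδ P hP hcore hstat hEq.le).exists
    refine ⟨Literature.MathematicalPhysics.StatisticalMechanics.hcpPeriodicConfiguration ha hh,
      ⟨⟨_, rfl⟩, ?_⟩, ?_⟩
    · rintro _ ⟨Q, rfl⟩
      rw [hAe]
      exact ciInf_le hBdd Q
    · rw [hAe]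
      exact hLim
  · -- conjunct (ii): the shared finite-N hinge and the proved minimal-distance fact
    exact hCharged (hHinge hPalm hBS hLim)
      Literature.MathematicalPhysics.StatisticalMechanics.LennardJonesMinimalDistance_holds

end Summit.AtomisticToContinuum.Crystallization.Theses.PalmUnimodularRigidity
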